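import Summits.QuantumFields.YangMills.Theorems.SqueezedSkewnessTorusKLComplexSpectral
import HarnessLib

/-!
# Route `SqueezedSkewness`, crux `SpectralIdentificationL` (stmt-QuantumFields-22796), stub `stub_osData` — OS-DATA layer (O2):
# THE COMPLEX SPECTRAL PACKAGE OF THE `Fin`-TORUS WITH THE OPERATOR-NORM BOUND OF THE TRANSFER OPERATOR

`exists_complex_spectral_package_norm` = layer (K4c) `TorusKL.exists_complex_spectral_package` of seat g16 VERBATIM (transfer operator
`A'`, translations `U'`, bond operators `X'`, eigenvalue classes `C` with joint eigenvectors, trace formula, one-point and site-resolved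
two-point functions of every period as sums over the classes) with ONE extra conjunct needed by the thermodynamic limit:
`‖A' g‖ ≤ Λ ‖g‖` for every `Λ ≥ 0` bounding the classes (`∀ c ∈ C, c ≤ Λ`).  REASON for the copy: the g16 package is an existential
statement, so the norm of ITS `A'` cannot be bounded after the fact; the bound is proved here inside the same construction from the real
Hilbert eigenbasis `A bᵢ = λᵢ bᵢ` (`λᵢ ≥ 0`; every positive `λᵢ` is a class) by Parseval (`norm_apply_le_of_eigenbasis`) and carried to the
complexification `A' (J f) = J (A f)` through `g = J(Re g) + i J(Im g)`, `‖J a + i J b‖² = ‖a‖² + ‖b‖²` (`norm_apply_le_of_complexification`).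
Downstream (layer O3) this gives `‖P_k‖ ≤ 1` for the projected one-step operators `P_k = λ₀⁻¹ (1−|e_k⟩⟨e_k|) A' (1−|e_k⟩⟨e_k|)` of the TOP
class `λ₀ = max C`, i.e. the contraction property `‖P‖ ≤ 1` demanded by `stub_osData`.
Seat `ym-line-fcl-p3` g17 (cell ym-idea-1; free hands); route-independent imports; `[folklore]` (Lüscher 1977; Reed–Simon I §VI;
Montvay–Münster §3.2.6); nothing about a summit, NT or the mass gap is proved here.
-/

set_option autoImplicit false

noncomputable section
open MeasureTheory Filter Function
open scoped InnerProductSpace ComplexConjugate ENNReal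
open Literature.MathematicalPhysics.QuantumFieldTheory Literature.Barriers.QuantumFields
open Literature.Analysis.OperatorTheory
open Summit.QuantumFields.YangMills.Theorems.TorusKL.ComplexBridge

namespace Summit.QuantumFields.YangMills.Theorems.TorusKL

/-! ## §1 Generic norm bounds: real eigenbasis and complexification -/

namespace OSData

/-- **Parseval bound.**  If `A bᵢ = λᵢ bᵢ` on a real Hilbert basis, `A` is symmetric and `|λᵢ| ≤ Λ`, then `‖A f‖ ≤ Λ ‖f‖`.
[cite: ReedSimonI1980, Thm II.6] -/
theorem norm_apply_le_of_eigenbasis {ι E : Type*} [NormedAddCommGroup E] [InnerProductSpace ℝ E] (b : HilbertBasis ι ℝ E)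
    (A : E →L[ℝ] E) (lam : ι → ℝ) (hb : ∀ i, A (b i) = lam i • b i) (hAsym : ∀ f f', ⟪A f, f'⟫_ℝ = ⟪f, A f'⟫_ℝ)
    {Λ : ℝ} (hΛ : 0 ≤ Λ) (hle : ∀ i, |lam i| ≤ Λ) (f : E) : ‖A f‖ ≤ Λ * ‖f‖ := by
  have h1 := b.hasSum_inner_mul_inner (A f) (A f)
  have h2 := (b.hasSum_inner_mul_inner f f).mul_left (Λ ^ 2)
  have key : ∀ i, ⟪b i, A f⟫_ℝ = lam i * ⟪b i, f⟫_ℝ := fun i => by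
    rw [← hAsym, hb, real_inner_smul_left]
  have hterm : ∀ i, ⟪A f, b i⟫_ℝ * ⟪b i, A f⟫_ℝ ≤ Λ ^ 2 * (⟪f, b i⟫_ℝ * ⟪b i, f⟫_ℝ) := by
    intro i
    rw [real_inner_comm (b i) (A f), key, real_inner_comm (b i) f]
    have hsq : (lam i) ^ 2 ≤ Λ ^ 2 := by
      have := hle i
      rw [← sq_abs]; exact pow_le_pow_left₀ (abs_nonneg _) this 2
    nlinarith [mul_self_nonneg ⟪b i, f⟫_ℝ, hsq]
  have h3 : ⟪A f, A f⟫_ℝ ≤ Λ ^ 2 * ⟪f, f⟫_ℝ := hasSum_le hterm h1 h2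
  rw [real_inner_self_eq_norm_sq, real_inner_self_eq_norm_sq, ← mul_pow] at h3
  exact (pow_le_pow_iff_left₀ (norm_nonneg _) (mul_nonneg hΛ (norm_nonneg _)) two_ne_zero).1 h3

/-- `‖J a + i • J b‖² = ‖a‖² + ‖b‖²` for the complexification `J : L²(X;ℝ) → L²(X;ℂ)`. [folklore] -/
theorem norm_sq_ofRealLp_add_I_smul {X : Type*} [MeasurableSpace X] {μ : Measure X} (a b : Lp ℝ 2 μ) :
    ‖(Complex.ofRealCLM.compLpL 2 μ a : Lp ℂ 2 μ) + Complex.I • Complex.ofRealCLM.compLpL 2 μ b‖ ^ 2 = ‖a‖ ^ 2 + ‖b‖ ^ 2 := by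
  rw [norm_add_sq (𝕜 := ℂ), inner_smul_right, inner_ofRealLp_ofRealLp, norm_smul, Complex.norm_I, one_mul, norm_ofRealLp,
    norm_ofRealLp]
  have h0 : RCLike.re (Complex.I * ((⟪a, b⟫_ℝ : ℝ) : ℂ)) = 0 := by
    rw [RCLike.re_to_complex, Complex.I_mul_re, Complex.ofReal_im, neg_zero]
  rw [h0, mul_zero, add_zero]

/-- **Complexification bound.**  If `A' (J f) = J (A f)` and `‖A f‖ ≤ Λ ‖f‖` on `L²(X;ℝ)`, then `‖A' g‖ ≤ Λ ‖g‖` on `L²(X;ℂ)`.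
[folklore] -/
theorem norm_apply_le_of_complexification {X : Type*} [MeasurableSpace X] {μ : Measure X} (A : Lp ℝ 2 μ →L[ℝ] Lp ℝ 2 μ)
    (A' : Lp ℂ 2 μ →L[ℂ] Lp ℂ 2 μ) (hAJ : ∀ f, A' (Complex.ofRealCLM.compLpL 2 μ f) = Complex.ofRealCLM.compLpL 2 μ (A f))
    {Λ : ℝ} (hΛ : 0 ≤ Λ) (hA : ∀ f, ‖A f‖ ≤ Λ * ‖f‖) (g : Lp ℂ 2 μ) : ‖A' g‖ ≤ Λ * ‖g‖ := by
  have hg := ofRealLp_re_add_I_smul_ofRealLp_im g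
  have hAg : A' g = Complex.ofRealCLM.compLpL 2 μ (A (Complex.reCLM.compLpL 2 μ g)) +
      Complex.I • Complex.ofRealCLM.compLpL 2 μ (A (Complex.imCLM.compLpL 2 μ g)) := by
    conv_lhs => rw [← hg]
    rw [map_add, map_smul, hAJ, hAJ]
  have h1 : ‖A' g‖ ^ 2 = ‖A (Complex.reCLM.compLpL 2 μ g)‖ ^ 2 + ‖A (Complex.imCLM.compLpL 2 μ g)‖ ^ 2 := by
    rw [hAg, norm_sq_ofRealLp_add_I_smul]
  have h2 : ‖g‖ ^ 2 = ‖Complex.reCLM.compLpL 2 μ g‖ ^ 2 + ‖Complex.imCLM.compLpL 2 μ g‖ ^ 2 := by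
    conv_lhs => rw [← hg]
    rw [norm_sq_ofRealLp_add_I_smul]
  have h3 : ‖A' g‖ ^ 2 ≤ (Λ * ‖g‖) ^ 2 := by
    rw [h1, mul_pow, h2, mul_add]
    have ha := hA (Complex.reCLM.compLpL 2 μ g)
    have hb := hA (Complex.imCLM.compLpL 2 μ g)
    have ha2 := pow_le_pow_left₀ (norm_nonneg _) ha 2
    have hb2 := pow_le_pow_left₀ (norm_nonneg _) hb 2
    rw [mul_pow] at ha2 hb2
    exact add_le_add ha2 hb2
  exact (pow_le_pow_iff_left₀ (norm_nonneg _) (mul_nonneg hΛ (norm_nonneg _)) two_ne_zero).1 h3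

end OSData

/-! ## §2 The complex spectral package with the norm bound -/

variable {S : ℕ} [NeZero S] {G : Type*} [Group G] [TopologicalSpace G] [IsTopologicalGroup G] [CompactSpace G] [MeasurableSpace G]
  [BorelSpace G] [SecondCountableTopology G] {N : ℕ} (ρ : G →* Matrix (Fin N) (Fin N) ℂ) (β : ℝ)

/-- ★ **THE COMPLEX SPECTRAL PACKAGE OF THE `Fin`-TORUS WITH THE NORM BOUND** — `TorusKL.exists_complex_spectral_package` (g16, layer K4c)
verbatim plus the conjunct `∀ Λ ≥ 0, (∀ c ∈ C, c ≤ Λ) → ‖A' g‖ ≤ Λ ‖g‖` (every positive eigenvalue of the real transfer operator is a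
class, Parseval, complexification).  [cite: Luscher1977] [cite: MontvayMunster1994, §3.2.6 (3.145)] [cite: ReedSimonI1980, Thm VI.23] -/
theorem exists_complex_spectral_package_norm (hρ : Continuous ρ) (hρu : ∀ g, ρ g ∈ Matrix.unitaryGroup (Fin N) ℂ) (hβ : 0 ≤ β) :
    ∃ (A' : Lp ℂ 2 (Measure.pi fun _ : FinSpatialSite S S S × Fin 3 => haarProbability G) →L[ℂ]
        Lp ℂ 2 (Measure.pi fun _ : FinSpatialSite S S S × Fin 3 => haarProbability G))
      (U' : FinSpatialSite S S S → Lp ℂ 2 (Measure.pi fun _ : FinSpatialSite S S S × Fin 3 => haarProbability G) →L[ℂ]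
        Lp ℂ 2 (Measure.pi fun _ : FinSpatialSite S S S × Fin 3 => haarProbability G))
      (X' : FinSpatialSite S S S → Lp ℂ 2 (Measure.pi fun _ : FinSpatialSite S S S × Fin 3 => haarProbability G) →L[ℂ]
        Lp ℂ 2 (Measure.pi fun _ : FinSpatialSite S S S × Fin 3 => haarProbability G))
      (C : Set ℝ) (_ : C.Countable) (d : C → (Fin 3 → ZMod S) → ℕ)
      (e : (c : C) → (Σ q : Fin 3 → ZMod S, Fin (d c q)) →
        Lp ℂ 2 (Measure.pi fun _ : FinSpatialSite S S S × Fin 3 => haarProbability G)),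
      IsSelfAdjoint A' ∧ IsCompactOperator A' ∧ (∀ g, 0 ≤ RCLike.re ⟪A' g, g⟫_ℂ) ∧
      U' 0 = 1 ∧ (∀ v w, U' (v + w) = U' v * U' w) ∧ (∀ v g, ‖U' v g‖ = ‖g‖) ∧ (∀ v, A' * U' v = U' v * A') ∧
      (∀ p v, X' (p + v) * U' v = U' v * X' p) ∧
      (∀ c : C, 0 < (c : ℝ)) ∧ (∀ c, Orthonormal ℂ (e c)) ∧ (∀ c k, A' (e c k) = ((c : ℝ) : ℂ) • e c k) ∧
      (∀ c k (γ : Fin 3 → ZMod S),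
        U' ((ZMod.finEquiv S).symm (γ 0), (ZMod.finEquiv S).symm (γ 1), (ZMod.finEquiv S).symm (γ 2)) (e c k) =
          (∏ j, ZMod.stdAddChar (k.1 j * γ j)) • e c k) ∧
      (∀ m : ℕ, HasSum (fun c : C => (c : ℝ) ^ (m + 2) * (Fintype.card (Σ q : Fin 3 → ZMod S, Fin (d c q)) : ℝ))
        (wilsonFinTorusPartition ρ β S S S (m + 2))) ∧
      (∀ (T M : ℕ) (_ : T = M + 3) (p : FinSpatialSite S S S) (t : Fin T),
        HasSum (fun c : C => ((c : ℝ) : ℂ) ^ (M + 2) * ∑ k, ⟪e c k, X' p (e c k)⟫_ℂ)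
          ((∫ U : FinTorusSite S S S T × Fin 4 → G,
            (∑ q : {q : Fin 4 × Fin 4 // q.1 < q.2}, (ρ (finTorusPlaquette U (p.toSite t) q.1.1 q.1.2)).trace.re) *
              Real.exp (-β * ∑ x : FinTorusSite S S S T, ∑ q : {q : Fin 4 × Fin 4 // q.1 < q.2},
                ((N : ℝ) - (ρ (finTorusPlaquette U x q.1.1 q.1.2)).trace.re))
            ∂(Measure.pi fun _ : FinTorusSite S S S T × Fin 4 => haarProbability G) : ℝ) : ℂ)) ∧
      (∀ (T M : ℕ) (_ : T = M + 3) (p : FinSpatialSite S S S) (t : Fin T),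
        HasSum (fun c : C => ((c : ℝ) : ℂ) ^ (M + 2) * ∑ k, ⟪e c k, X' p (e c k)⟫_ℂ)
          ((∫ U : FinTorusSite S S S T × Fin 4 → G,
            (∑ q : {q : Fin 4 × Fin 4 // q.1 < q.2}, (ρ (finTorusPlaquette
                (fun e : FinTorusSite S S S T × Fin 4 => if e.2 = Fin.last 3 then
                  (U ((e.1.1, e.1.2.1, e.1.2.2.1, Fin.rev e.1.2.2.2), Fin.last 3))⁻¹
                else U ((e.1.1, e.1.2.1, e.1.2.2.1, ⟨(T - e.1.2.2.2.val) % T, Nat.mod_lt _ e.1.2.2.2.pos⟩), e.2))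
                (p.toSite t) q.1.1 q.1.2)).trace.re) *
              Real.exp (-β * ∑ x : FinTorusSite S S S T, ∑ q : {q : Fin 4 × Fin 4 // q.1 < q.2},
                ((N : ℝ) - (ρ (finTorusPlaquette U x q.1.1 q.1.2)).trace.re))
            ∂(Measure.pi fun _ : FinTorusSite S S S T × Fin 4 => haarProbability G) : ℝ) : ℂ)) ∧
      (∀ (a b' K : ℕ) (_ : K = a + b' + 4) (p p' : FinSpatialSite S S S) (t t' : Fin (K + 1)) (_ : 1 ≤ (t : ℕ))
        (_ : (t : ℕ) + t' = b' + 2),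
        HasSum (fun c : C => ((c : ℝ) : ℂ) ^ (a + 1) * ∑ k, ⟪X' p (e c k), (A' ^ (b' + 2)) (X' p' (e c k))⟫_ℂ)
          ((∫ U : FinTorusSite S S S (K + 1) × Fin 4 → G,
            ((∑ q : {q : Fin 4 × Fin 4 // q.1 < q.2}, (ρ (finTorusPlaquette U (p'.toSite t') q.1.1 q.1.2)).trace.re) *
              ∑ q : {q : Fin 4 × Fin 4 // q.1 < q.2}, (ρ (finTorusPlaquette
                (fun e : FinTorusSite S S S (K + 1) × Fin 4 => if e.2 = Fin.last 3 then
                  (U ((e.1.1, e.1.2.1, e.1.2.2.1, Fin.rev e.1.2.2.2), Fin.last 3))⁻¹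
                else U ((e.1.1, e.1.2.1, e.1.2.2.1, ⟨(K + 1 - e.1.2.2.2.val) % (K + 1), Nat.mod_lt _ e.1.2.2.2.pos⟩), e.2))
                (p.toSite t) q.1.1 q.1.2)).trace.re) *
              Real.exp (-β * ∑ x : FinTorusSite S S S (K + 1), ∑ q : {q : Fin 4 × Fin 4 // q.1 < q.2},
                ((N : ℝ) - (ρ (finTorusPlaquette U x q.1.1 q.1.2)).trace.re))
            ∂(Measure.pi fun _ : FinTorusSite S S S (K + 1) × Fin 4 => haarProbability G) : ℝ) : ℂ)) ∧
      (∀ Λ : ℝ, 0 ≤ Λ → (∀ c : C, (c : ℝ) ≤ Λ) →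
        ∀ g : Lp ℂ 2 (Measure.pi fun _ : FinSpatialSite S S S × Fin 3 => haarProbability G), ‖A' g‖ ≤ Λ * ‖g‖) := by
  classical
  set μ : Measure (FinSpatialSite S S S × Fin 3 → G) := Measure.pi fun _ : FinSpatialSite S S S × Fin 3 => haarProbability G
  have hK := stronglyMeasurable_uncurry_finTorusSliceKernel (b₁ := S) (b₂ := S) (b₃ := S) ρ hρ β
  obtain ⟨CK, hCK⟩ := exists_norm_finTorusSliceKernel_le (b₁ := S) (b₂ := S) (b₃ := S) ρ hρ β
  obtain ⟨A, X, ι, hcnt, b, lam, A', U', X', hA, hX, hb, hlam0, hS2, hZ, hAsym, hA'sa, hA'c, hA'pos, hU'0, hU'add, hU'norm, hU'A,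
    hX'U, hA', hAJ, hXJ, hUinv⟩ := exists_complex_operators (S := S) ρ β hρ hρu hβ
  haveI : Countable ι := hcnt
  -- the classes and their fibres
  have hCcnt : ({c : ℝ | 0 < c ∧ c ∈ Set.range lam} : Set ℝ).Countable := (Set.countable_range lam).mono fun c hc => hc.2
  have hCpos : ∀ c : ({c : ℝ | 0 < c ∧ c ∈ Set.range lam} : Set ℝ), 0 < (c : ℝ) := fun c => c.2.1
  have hfin := fun c : ({c : ℝ | 0 < c ∧ c ∈ Set.range lam} : Set ℝ) => finite_fibre hS2 (c := (c : ℝ)) (hCpos c).ne'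
  obtain ⟨s, hs_def⟩ : ∃ s : ({c : ℝ | 0 < c ∧ c ∈ Set.range lam} : Set ℝ) → Finset ι, s = fun c => (hfin c).toFinset :=
    ⟨_, rfl⟩
  have hs : ∀ (c : ({c : ℝ | 0 < c ∧ c ∈ Set.range lam} : Set ℝ)) i, i ∈ s c ↔ lam i = c := fun c i => by simp [hs_def]
  -- the translations indexed by `(ℤ/S)³`
  obtain ⟨toΓ, htoΓ⟩ : ∃ toΓ : (Fin 3 → ZMod S) → FinSpatialSite S S S, toΓ = fun γ =>
    ((ZMod.finEquiv S).symm (γ 0), (ZMod.finEquiv S).symm (γ 1), (ZMod.finEquiv S).symm (γ 2)) := ⟨_, rfl⟩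
  have htoΓ0 : toΓ 0 = 0 := by simp only [htoΓ, Pi.zero_apply, map_zero]; rfl
  have htoΓadd : ∀ γ γ', toΓ (γ + γ') = toΓ γ + toΓ γ' := fun γ γ' => by simp only [htoΓ, Pi.add_apply, map_add]; rfl
  obtain ⟨V, hV⟩ : ∃ V : (Fin 3 → ZMod S) → Lp ℂ 2 μ →L[ℂ] Lp ℂ 2 μ, V = fun γ => U' (toΓ γ) := ⟨_, rfl⟩
  have hV0 : V 0 = 1 := by rw [hV]; show U' (toΓ 0) = 1; rw [htoΓ0, hU'0]
  have hVadd : ∀ γ γ', V (γ + γ') = V γ * V γ' := fun γ γ' => by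
    rw [hV]; show U' (toΓ (γ + γ')) = U' (toΓ γ) * U' (toΓ γ'); rw [htoΓadd, hU'add]
  have hVnorm : ∀ γ g, ‖V γ g‖ = ‖g‖ := fun γ g => by rw [hV]; exact hU'norm _ g
  -- the complexified basis vectors are orthonormal
  have hJon : Orthonormal ℂ fun i : ι => (Complex.ofRealCLM.compLpL 2 μ (b i) : Lp ℂ 2 μ) := orthonormal_ofRealLp b.orthonormal
  -- adapted families, class by class
  have key : ∀ c : ({c : ℝ | 0 < c ∧ c ∈ Set.range lam} : Set ℝ), ∃ (d : (Fin 3 → ZMod S) → ℕ) (e : (Σ q : Fin 3 → ZMod S, Fin (d q)) → Lp ℂ 2 μ),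
      Orthonormal ℂ e ∧ (∀ k, e k ∈ Submodule.span ℂ ((fun i : ι => (Complex.ofRealCLM.compLpL 2 μ (b i) : Lp ℂ 2 μ)) '' (s c : Set ι))) ∧
      (∀ k γ, V γ (e k) = (∏ j, ZMod.stdAddChar (k.1 j * γ j)) • e k) ∧
      ∀ T : Lp ℂ 2 μ →L[ℂ] Lp ℂ 2 μ, ∑ k, ⟪e k, T (e k)⟫_ℂ = ∑ i ∈ s c, ⟪(Complex.ofRealCLM.compLpL 2 μ (b i) : Lp ℂ 2 μ),
        T (Complex.ofRealCLM.compLpL 2 μ (b i))⟫_ℂ := by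
    intro c
    refine AdaptedBasis.exists_adapted_orthonormal_family (fun q γ : Fin 3 → ZMod S => ∏ j, ZMod.stdAddChar (q j * γ j)) V
      SqueezedSkewnessJointDiagonal.bichar_add SqueezedSkewnessJointDiagonal.bichar_conj SqueezedSkewnessJointDiagonal.bichar_orth
      SqueezedSkewnessJointDiagonal.bichar_dual hV0 hVadd hVnorm hJon (s c) fun γ i hi => ?_
    -- invariance of the class span
    have hi' : lam i = c := (hs c i).1 hi
    have h := hUinv (toΓ γ) i (by rw [hi']; exact (hCpos c).ne')
    have hset : (Set.range fun j : {j : ι // lam j = lam i} => (Complex.ofRealCLM.compLpL 2 μ (b j) : Lp ℂ 2 μ)) =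
        (fun i : ι => (Complex.ofRealCLM.compLpL 2 μ (b i) : Lp ℂ 2 μ)) '' (s c : Set ι) := by
      ext g
      simp only [Set.mem_range, Set.mem_image, Finset.mem_coe, hs, Subtype.exists, hi', exists_prop]
    rw [hset] at h
    rw [hV]
    exact h
  choose d e horth hmem heig htrace using key
  -- eigenvectors of `A'`
  have hAe : ∀ c k, A' (e c k) = ((c : ℝ) : ℂ) • e c k := by
    intro c k
    refine apply_eq_smul_of_mem_span_fibre hK hCK hA hA' hb (s := s c) (fun i hi => (hs c i).1 hi) ?_
    have h := hmem c k
    rw [Set.image_eq_range] at h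
    exact h
  -- matrix elements on the complexified basis
  have hJJ : ∀ f f' : Lp ℝ 2 μ, ⟪(Complex.ofRealCLM.compLpL 2 μ f : Lp ℂ 2 μ), Complex.ofRealCLM.compLpL 2 μ f'⟫_ℂ =
      ((⟪f, f'⟫_ℝ : ℝ) : ℂ) := inner_ofRealLp_ofRealLp
  have hcard : ∀ c : ({c : ℝ | 0 < c ∧ c ∈ Set.range lam} : Set ℝ), (Fintype.card (Σ q : Fin 3 → ZMod S, Fin (d c q)) : ℂ) = ((s c).card : ℂ) := by
    intro c
    have h := htrace c 1
    simp only [one_apply_eq_self] at h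
    have h1 : ∀ k, ⟪e c k, e c k⟫_ℂ = 1 := fun k => by
      rw [inner_self_eq_norm_sq_to_K, (horth c).norm_eq_one]; simp
    have h2 : ∀ i, ⟪(Complex.ofRealCLM.compLpL 2 μ (b i) : Lp ℂ 2 μ), Complex.ofRealCLM.compLpL 2 μ (b i)⟫_ℂ = 1 := fun i => by
      rw [hJJ, real_inner_self_eq_norm_sq, b.orthonormal.norm_eq_one]; simp
    simp only [h1, h2, Finset.sum_const, Finset.card_univ, nsmul_eq_mul, mul_one] at h
    exact h
  have hT1 : ∀ (c : ({c : ℝ | 0 < c ∧ c ∈ Set.range lam} : Set ℝ)) p, ∑ k, ⟪e c k, X' p (e c k)⟫_ℂ = ∑ i ∈ s c, ((⟪b i, X p (b i)⟫_ℝ : ℝ) : ℂ) := by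
    intro c p
    rw [htrace c (X' p)]
    refine Finset.sum_congr rfl fun i _ => ?_
    rw [hXJ, hJJ]
  have hT2 : ∀ (c : ({c : ℝ | 0 < c ∧ c ∈ Set.range lam} : Set ℝ)) p p' (n : ℕ), ∑ k, ⟪X' p (e c k), (A' ^ n) (X' p' (e c k))⟫_ℂ =
      ∑ i ∈ s c, ((⟪X p (b i), (A ^ n) (X p' (b i))⟫_ℝ : ℝ) : ℂ) := by
    intro c p p' n
    have hApow : ∀ f, (A' ^ n) (Complex.ofRealCLM.compLpL 2 μ f) = Complex.ofRealCLM.compLpL 2 μ ((A ^ n) f) :=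
      pow_comp_ofRealLp hAJ n
    obtain ⟨T, hT⟩ : ∃ T : Lp ℂ 2 μ →L[ℂ] Lp ℂ 2 μ, T = ContinuousLinearMap.adjoint (X' p) * ((A' ^ n) * X' p') := ⟨_, rfl⟩
    have hTe : ∀ g : Lp ℂ 2 μ, ⟪g, T g⟫_ℂ = ⟪X' p g, (A' ^ n) (X' p' g)⟫_ℂ := fun g => by
      rw [hT, mul_apply_eq_comp, mul_apply_eq_comp, ContinuousLinearMap.adjoint_inner_right]
    have h := htrace c T
    simp only [hTe] at h
    rw [h]
    refine Finset.sum_congr rfl fun i _ => ?_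
    rw [hXJ, hXJ, hApow, hJJ]
  -- class sums of powers
  have hpow : ∀ (c : ({c : ℝ | 0 < c ∧ c ∈ Set.range lam} : Set ℝ)) (n : ℕ) (g : ι → ℝ), ∑ i ∈ s c, lam i ^ n * g i = (c : ℝ) ^ n * ∑ i ∈ s c, g i := by
    intro c n g
    rw [Finset.mul_sum]
    refine Finset.sum_congr rfl fun i hi => ?_
    rw [(hs c i).1 hi]
  refine ⟨A', U', X', {c : ℝ | 0 < c ∧ c ∈ Set.range lam}, hCcnt, d, e, hA'sa, hA'c, hA'pos, hU'0, hU'add, hU'norm, hU'A, hX'U, hCpos, horth, hAe,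
    fun c k γ => by have h := heig c k γ; rw [hV, htoΓ] at h; exact h, fun m => ?_, fun T M hT p t => ?_, fun T M hT p t => ?_, fun a b' K hK' p p' t t' ht htt => ?_,
    fun Λ hΛ hle g => ?_⟩
  · -- the trace formula over the classes
    have h := hasSum_classes (hZ m) lam hlam0 (fun i hi => by rw [hi, zero_pow (by omega)]) s hs
    have hfun : (fun c : ({c : ℝ | 0 < c ∧ c ∈ Set.range lam} : Set ℝ) => ∑ i ∈ s c, lam i ^ (m + 2)) =
        fun c : ({c : ℝ | 0 < c ∧ c ∈ Set.range lam} : Set ℝ) => (c : ℝ) ^ (m + 2) * (Fintype.card (Σ q : Fin 3 → ZMod S, Fin (d c q)) : ℝ) := by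
      funext c
      have h1 := hpow c (m + 2) (fun _ => 1)
      simp only [mul_one, Finset.sum_const, nsmul_eq_mul] at h1
      rw [h1]
      have h2 := hcard c
      norm_cast at h2
      rw [h2]
    rw [hfun] at h; exact h
  · -- one point
    have h := hasSum_classes (hasSum_site_onePoint ρ β hρ hρu hβ hT p t hA hb (hX p)) lam hlam0
      (fun i hi => by rw [hi, zero_pow (by omega), zero_mul]) s hs
    have h' := (Complex.hasSum_ofReal (L := SummationFilter.unconditional _)).2 h
    have hfun : (fun c : ({c : ℝ | 0 < c ∧ c ∈ Set.range lam} : Set ℝ) => (((∑ i ∈ s c, lam i ^ (M + 2) * ⟪b i, X p (b i)⟫_ℝ) : ℝ) : ℂ)) =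
        fun c : ({c : ℝ | 0 < c ∧ c ∈ Set.range lam} : Set ℝ) => ((c : ℝ) : ℂ) ^ (M + 2) * ∑ k, ⟪e c k, X' p (e c k)⟫_ℂ := by
      funext c; rw [hpow, hT1]; push_cast; rfl
    rw [hfun] at h'; exact h'
  · -- reflected one point
    have h := hasSum_classes (hasSum_site_onePoint_refl ρ β hρ hρu hβ hT p t hA hb (hX p)) lam hlam0
      (fun i hi => by rw [hi, zero_pow (by omega), zero_mul]) s hs
    have h' := (Complex.hasSum_ofReal (L := SummationFilter.unconditional _)).2 h
    have hfun : (fun c : ({c : ℝ | 0 < c ∧ c ∈ Set.range lam} : Set ℝ) => (((∑ i ∈ s c, lam i ^ (M + 2) * ⟪b i, X p (b i)⟫_ℝ) : ℝ) : ℂ)) =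
        fun c : ({c : ℝ | 0 < c ∧ c ∈ Set.range lam} : Set ℝ) => ((c : ℝ) : ℂ) ^ (M + 2) * ∑ k, ⟪e c k, X' p (e c k)⟫_ℂ := by
      funext c; rw [hpow, hT1]; push_cast; rfl
    rw [hfun] at h'; exact h'
  · -- two points
    have h := hasSum_classes (hasSum_site_twoPoint ρ β hρ hρu hβ hK' p p' t t' ht htt hA hb (hX p) (hX p')) lam hlam0
      (fun i hi => by rw [hi, zero_pow (by omega), zero_mul]) s hs
    have h' := (Complex.hasSum_ofReal (L := SummationFilter.unconditional _)).2 h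
    have hfun : (fun c : ({c : ℝ | 0 < c ∧ c ∈ Set.range lam} : Set ℝ) => (((∑ i ∈ s c, lam i ^ (a + 1) * ⟪X p (b i), (A ^ (b' + 2)) (X p' (b i))⟫_ℝ) : ℝ) : ℂ)) =
        fun c : ({c : ℝ | 0 < c ∧ c ∈ Set.range lam} : Set ℝ) => ((c : ℝ) : ℂ) ^ (a + 1) * ∑ k, ⟪X' p (e c k), (A' ^ (b' + 2)) (X' p' (e c k))⟫_ℂ := by
      funext c; rw [hpow, hT2]; push_cast; rfl
    rw [hfun] at h'; exact h'
  · -- ★ the operator norm of `A'` is at most any bound of the positive classes (new conjunct, seat g17)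
    have hlamle : ∀ i, |lam i| ≤ Λ := by
      intro i
      rw [abs_of_nonneg (hlam0 i)]
      by_cases h0 : lam i = 0
      · rw [h0]; exact hΛ
      · exact hle ⟨lam i, lt_of_le_of_ne (hlam0 i) (Ne.symm h0), i, rfl⟩
    exact OSData.norm_apply_le_of_complexification A A' hAJ hΛ
      (OSData.norm_apply_le_of_eigenbasis b A lam hb hAsym hΛ hlamle) g


end Summit.QuantumFields.YangMills.Theorems.TorusKL

end
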